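import Literature.Geometry.Lorentzian.KerrRadiusConditionalPseudoconvexity
import Literature.Geometry.Lorentzian.KerrSchildTimeTranslation
import Summits.FinalStateConjecture.FinalStateConjecture.Theorems.BartnikGapSettlingGapExhaustionCylindersExactMargin
import HarnessLib

/-!
# Crux `GapExhaustion` (stmt-FinalStateConjecture-10808), line `photon-shell-pseudoconvexity`:
# stub (T-B) `stub_kerrZeroEnergyExactMargin` — uniform `T`-conditional inward bending of the
# Kerr cylinders at every radius beyond the horizon

Route `BartnikGapSettling`; helper (`--supports stmt-FinalStateConjecture-10808`) landing the
registered sub-stub (T-B), the `T`-conditional analogue of (B) `stub_kerrCylindersExactMargin`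
(Ionescu–Klainerman, Invent. Math. 175 (2009), §3.1, condition (HoCond2)): **for a band
`r₊ < r_lo ≤ r ≤ r_e` (no photon-orbit bound) there is `m > 0` such that at every point of the
band (all Kerr-star times, axis included) every null vector `w` tangent to the cylinder AND
orthogonal to the stationary Killing field `∂₀ = E4.basisVector 0` has `Hess r(w, w) ≤ −m‖w‖²`**
(exact Kerr, Kerr–Schild Cartesian coordinates).

The pointwise strict sign is `Kerr.hessAt_radius_neg_of_bilin_basisVector_zero` (Literature
`KerrRadiusConditionalPseudoconvexity.lean`). Uniformity exactly as for (B): the constraint set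
`{(z, w) : z⁰ = 0, r_lo ≤ r(z) ≤ r_e, ‖w‖ = 1, g_z(w,w) = 0, dr_z(w) = 0, g_z(∂₀, w) = 0}` is
compact and `(z, w) ↦ Hess r_z(w,w)` is continuous on it, so its maximum is `< 0`; homogeneity
in `w` (all three constraints are homogeneous, the new one linear) and stationarity of Kerr
(`Kerr.bilin_add_time`, `Kerr.radius_add_time_smul_basisVector`,
`kerrCylindersExactMargin_hessAt_add_time`) remove the normalisations.
-/

noncomputable section

-- instance search through the nested operator types `E4 →L[ℝ] E4 →L[ℝ] E4 →L[ℝ] ℝ`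
set_option maxSynthPendingDepth 3

-- D-0017: single-problem summit, `Summit.<S>.<S>.…` by design (cf. lakefile `weak.linter.dupNamespace`).
set_option linter.dupNamespace false

namespace Summit.FinalStateConjecture.FinalStateConjecture.Theorems

open Set Literature.Geometry.Lorentzian Literature.Geometry.Lorentzian.MetricCoord
open scoped Manifold ContDiff Topology ENNReal

/-- `(z, w) ↦ g_z(∂₀, w)` is continuous on `region × E4` (the zero-energy constraint is closed). -/
theorem zeroEnergyExactMargin_continuousOn_bilin_basisVector_apply (M a r₀ : ℝ) :
    ContinuousOn (fun p : E4 × E4 ↦ Kerr.bilin M a p.1 (E4.basisVector 0) p.2)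
      ((Kerr.region a r₀ : Set E4) ×ˢ (univ : Set E4)) := by
  have h : ContinuousOn (fun p : E4 × E4 ↦ Kerr.bilin M a p.1)
      ((Kerr.region a r₀ : Set E4) ×ˢ (univ : Set E4)) :=
    ((KerrSchildChart.isMetricOn_kerrBilin M a r₀).contDiffOn.continuousOn).comp
      (continuous_fst : Continuous (Prod.fst : E4 × E4 → E4)).continuousOn (fun p hp ↦ (mem_prod.1 hp).1)
  exact (h.clm_apply continuousOn_const).clm_apply
    (continuous_snd : Continuous (Prod.snd : E4 × E4 → E4)).continuousOn

/-- **Stub (T-B) of the line `photon-shell-pseudoconvexity` (crux `GapExhaustion`,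
stmt-FinalStateConjecture-10808) — uniform `T`-conditional inward bending of the Kerr cylinders
at every radius beyond the horizon.** For `0 < M`, `|a| < M` and a band `r₊ < r_lo < r_e` there
is `m > 0` such that at every point `z` of Kerr–Schild coordinate space with `r_lo ≤ r(z) ≤ r_e`
(all times, axis included) every vector `w` null for `g_{M,a}`, tangent to `{r = r(z)}` and
orthogonal to the stationary Killing field `∂₀` satisfies `Hess r_z(w, w) ≤ −m‖w‖²`
(Ionescu–Klainerman, Invent. Math. 175 (2009), §3.1 (HoCond2), uniform form). Pointwise sign:
`Kerr.hessAt_radius_neg_of_bilin_basisVector_zero`; uniformity by compactness of the normalised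
constraint set on the slice `{z⁰ = 0}` and stationarity. -/
theorem stub_kerrZeroEnergyExactMargin :
    ∀ (M a r_lo r_e : ℝ), 0 < M → |a| < M → Kerr.rPlus M a < r_lo → r_lo < r_e →
      ∃ m : ℝ, 0 < m ∧ ∀ (z w : E4), r_lo ≤ Kerr.radius a z → Kerr.radius a z ≤ r_e →
        Kerr.bilin M a z w w = 0 → fderiv ℝ (Kerr.radius a) z w = 0 →
        Kerr.bilin M a z (E4.basisVector 0) w = 0 →
        hessAt (Kerr.bilin M a) (Kerr.radius a) z w w ≤ -m * ‖w‖ ^ 2 := by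
  intro M a r_lo r_e hM ha hlo hloe
  have hrp : 0 < Kerr.rPlus M a := by
    have : M ≤ Kerr.rPlus M a := by
      unfold Kerr.rPlus; linarith [Real.sqrt_nonneg (M ^ 2 - a ^ 2)]
    linarith
  have hlo0 : 0 < r_lo := hrp.trans hlo
  -- the normalised constraint set on the slice `{z⁰ = 0}`
  set S : Set E4 := {z : E4 | z 0 = 0 ∧ r_lo ≤ Kerr.radius a z ∧ Kerr.radius a z ≤ r_e} with hS
  set K : Set (E4 × E4) := {p | p.1 ∈ S ∧ ‖p.2‖ = 1 ∧ Kerr.bilin M a p.1 p.2 p.2 = 0 ∧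
    fderiv ℝ (Kerr.radius a) p.1 p.2 = 0 ∧ Kerr.bilin M a p.1 (E4.basisVector 0) p.2 = 0} with hK
  have hSc : IsCompact S := kerrCylindersBendInward_isCompact_slice a r_e hlo0
  have hSreg : S ⊆ (Kerr.region a 0 : Set E4) := fun z hz ↦ by
    have : max 0 0 < Kerr.radius a z := by rw [max_self]; exact hlo0.trans_le hz.2.1
    exact this
  have hB : IsCompact (S ×ˢ Metric.sphere (0 : E4) 1) := hSc.prod (isCompact_sphere 0 1)
  have hBreg : S ×ˢ Metric.sphere (0 : E4) 1 ⊆ (Kerr.region a 0 : Set E4) ×ˢ (univ : Set E4) :=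
    prod_mono hSreg (subset_univ _)
  have hKeq : K = (S ×ˢ Metric.sphere (0 : E4) 1) ∩
      (fun p : E4 × E4 ↦ Kerr.bilin M a p.1 p.2 p.2) ⁻¹' {0} ∩
      (fun p : E4 × E4 ↦ fderiv ℝ (Kerr.radius a) p.1 p.2) ⁻¹' {0} ∩
      (fun p : E4 × E4 ↦ Kerr.bilin M a p.1 (E4.basisVector 0) p.2) ⁻¹' {0} := by
    ext p
    simp only [hK, mem_setOf_eq, mem_inter_iff, mem_prod, mem_sphere_iff_norm, sub_zero,
      mem_preimage, mem_singleton_iff]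
    tauto
  have hKc : IsCompact K := by
    have h1 : IsClosed ((S ×ˢ Metric.sphere (0 : E4) 1) ∩
        (fun p : E4 × E4 ↦ Kerr.bilin M a p.1 p.2 p.2) ⁻¹' {0}) :=
      ((kerrCylindersExactMargin_continuousOn_bilin_apply M a 0).mono hBreg).preimage_isClosed_of_isClosed
        hB.isClosed isClosed_singleton
    have h2 : IsClosed ((S ×ˢ Metric.sphere (0 : E4) 1) ∩
        (fun p : E4 × E4 ↦ Kerr.bilin M a p.1 p.2 p.2) ⁻¹' {0} ∩
        (fun p : E4 × E4 ↦ fderiv ℝ (Kerr.radius a) p.1 p.2) ⁻¹' {0}) :=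
      (((kerrCylindersExactMargin_continuousOn_fderiv_radius_apply a 0).mono hBreg).mono
        inter_subset_left).preimage_isClosed_of_isClosed h1 isClosed_singleton
    have h3 : IsClosed ((S ×ˢ Metric.sphere (0 : E4) 1) ∩
        (fun p : E4 × E4 ↦ Kerr.bilin M a p.1 p.2 p.2) ⁻¹' {0} ∩
        (fun p : E4 × E4 ↦ fderiv ℝ (Kerr.radius a) p.1 p.2) ⁻¹' {0} ∩
        (fun p : E4 × E4 ↦ Kerr.bilin M a p.1 (E4.basisVector 0) p.2) ⁻¹' {0}) :=
      (((zeroEnergyExactMargin_continuousOn_bilin_basisVector_apply M a 0).mono hBreg).mono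
        (inter_subset_left.trans inter_subset_left)).preimage_isClosed_of_isClosed h2
        isClosed_singleton
    rw [hKeq]
    exact hB.of_isClosed_subset h3
      ((inter_subset_left.trans inter_subset_left).trans inter_subset_left)
  -- the Hessian is continuous on `K` and negative there
  set F : E4 × E4 → ℝ := fun p ↦ hessAt (Kerr.bilin M a) (Kerr.radius a) p.1 p.2 p.2 with hF
  have hFc : ContinuousOn F K := by
    refine (kerrCylindersExactMargin_continuousOn_hessAt_apply M a 0).mono fun p hp ↦ ?_
    exact ⟨hSreg hp.1, mem_univ _⟩
  have hFneg : ∀ p ∈ K, F p < 0 := by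
    rintro ⟨z, w⟩ ⟨hz, hw1, hnull, htan, horth⟩
    have hw : w ≠ 0 := by
      rintro rfl; simp at hw1
    exact Kerr.hessAt_radius_neg_of_bilin_basisVector_zero hM ha.le (hlo.trans_le hz.2.1) hw hnull
      htan horth
  -- the margin
  obtain ⟨m, hm, hmK⟩ : ∃ m : ℝ, 0 < m ∧ ∀ p ∈ K, F p ≤ -m := by
    by_cases hne : K.Nonempty
    · obtain ⟨p₀, hp₀, hmax⟩ := hKc.exists_isMaxOn hne hFc
      refine ⟨-F p₀, by linarith [hFneg p₀ hp₀], fun p hp ↦ ?_⟩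
      have := hmax hp
      simp only [mem_setOf_eq] at this
      linarith
    · refine ⟨1, one_pos, fun p hp ↦ ?_⟩
      exact absurd ⟨p, hp⟩ hne
  refine ⟨m, hm, fun z w hz₁ hz₂ hnull htan horth ↦ ?_⟩
  by_cases hw : w = 0
  · subst hw; simp
  -- normalise: translate to the slice and rescale `w`
  set t : ℝ := z 0 with ht
  set z' : E4 := z + (-t) • E4.basisVector 0 with hz'
  clear_value t
  have hrad : Kerr.radius a z' = Kerr.radius a z := Kerr.radius_add_time_smul_basisVector a z (-t)
  have hbil : Kerr.bilin M a z' = Kerr.bilin M a z := Kerr.bilin_add_time M a (-t) z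
  have hfd : fderiv ℝ (Kerr.radius a) z' = fderiv ℝ (Kerr.radius a) z :=
    SwallowTheDatum.KerrShieldedSettles.KerrExteriorFlatDecay.fderiv_radius_add_time a z (-t)
  have hhess : hessAt (Kerr.bilin M a) (Kerr.radius a) z' =
      hessAt (Kerr.bilin M a) (Kerr.radius a) z :=
    kerrCylindersExactMargin_hessAt_add_time M a z (-t)
  have hz'0 : z' 0 = 0 := by
    simp [hz', ht, E4.basisVector]
  clear_value z'
  set c : ℝ := ‖w‖ with hc
  have hc0 : 0 < c := by rw [hc]; exact norm_pos_iff.2 hw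
  clear_value c
  set v : E4 := c⁻¹ • w with hv
  clear_value v
  have hv1 : ‖v‖ = 1 := by
    rw [hv, norm_smul, norm_inv, Real.norm_eq_abs, abs_of_pos hc0, ← hc, inv_mul_cancel₀ hc0.ne']
  have hwv : w = c • v := by
    rw [hv, smul_smul, mul_inv_cancel₀ hc0.ne', one_smul]
  have hnull' : Kerr.bilin M a z' v v = 0 := by
    rw [hbil, hv, map_smul, map_smul, smul_apply, smul_eq_mul, smul_eq_mul, hnull, mul_zero,
      mul_zero]
  have htan' : fderiv ℝ (Kerr.radius a) z' v = 0 := by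
    rw [hfd, hv, map_smul, smul_eq_mul, htan, mul_zero]
  have horth' : Kerr.bilin M a z' (E4.basisVector 0) v = 0 := by
    rw [hbil, hv, map_smul, smul_eq_mul, horth, mul_zero]
  have hmem : (z', v) ∈ K := ⟨⟨hz'0, hrad ▸ hz₁, hrad ▸ hz₂⟩, hv1, hnull', htan', horth'⟩
  have hle : hessAt (Kerr.bilin M a) (Kerr.radius a) z v v ≤ -m := by
    have := hmK _ hmem
    simp only [hF] at this
    rwa [hhess] at this
  have hsc : hessAt (Kerr.bilin M a) (Kerr.radius a) z w w =
      c ^ 2 * hessAt (Kerr.bilin M a) (Kerr.radius a) z v v := by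
    rw [hwv]
    simp only [map_smul, smul_apply, smul_eq_mul]
    ring
  rw [hsc]
  nlinarith [sq_nonneg c]

end Summit.FinalStateConjecture.FinalStateConjecture.Theorems

end
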